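import Mathlib.LinearAlgebra.Projection
import Literature.NumberTheory.DiophantineGeometry.SymmetricGroupCharacterProjectors
import Literature.NumberTheory.DiophantineGeometry.SchurWeylPlethysmProofs
import Literature.NumberTheory.DiophantineGeometry.SchurWeylHighestWeightProofs
import Literature.NumberTheory.DiophantineGeometry.SymmetricGroupRepsYoungSymmetrizerMulSelfProofs
import Literature.NumberTheory.DiophantineGeometry.PartitionTableauxProofs
import HarnessLib

/-!
# The majorisation property of the isotypic projectors on tensor powers, in coordinates

Topic file in the `SymmetricGroupReps` / Schur–Weyl series (trunk ArithGeomL / CplxAlg). On the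
coordinate model `Word N n → k` of `(k^N)^{⊗n}` (`TensorWordModel`, with `S_n` permuting the
positions, `wordPermRep`) we prove the **majorisation property** of Christandl–Vrana–Zuiddam,
Remark 3.33 ("`P_λ v_i ≠ 0` implies that the type of `i` is dominated by `λ`") in the following
support form, for an algebraically closed field `k` of characteristic zero:

* `card_filter_mem_le_of_mem_range_charSum` — every word `u` in the support of a vector in the
  range of the character sum `Z_λ = ∑_π χ^λ(π) π` (which is `n!/f^λ` times the isotypic projector
  `P_λ`, file `SymmetricGroupCharacterProjectors`) is *dominated by `λ`*: for every set `S` of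
  letters, `#{p | u p ∈ S} ≤ λ₁ + ⋯ + λ_{|S|}`; equivalently the decreasing rearrangement of the
  content of `u` is `⊴ λ`.

The proof is the classical one through Young symmetrizers (Fulton–Harris §4.1–4.2, §6.1;
Fulton, *Young Tableaux*, §7–8), organised as follows.

1. `colAntisymmetrizer_apply_apply_eq_zero` — the column antisymmetrizer `b_λ` of the canonical
   tableau kills, in every vector, the coordinates at words repeating a letter within a column
   (`q b_λ = sgn(q) b_λ` for the transposition `q` of the two positions).
2. `exists_colInjective_of_youngSymmetrizer_apply_ne_zero` — hence every word in the support of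
   `c_λ x = a_λ b_λ x` is a row permutation of a *column-injective* word.
3. `card_filter_mem_le_of_isColStrict` — a column-injective (`IsColStrict`) word is dominated by `λ`: a column of
   length `c` contains at most `min(|S|, c)` positions with letters in `S`, and
   `∑_j min(|S|, λ'_j) = λ₁ + ⋯ + λ_{|S|}` (counting the boxes of the first `|S|` rows by columns).
4. `card_filter_mem_le_of_mem_range_charSum` — the vectors supported on dominated words form a
   subrepresentation `M ⊇ c_λ · W`; the isotypic identities of `SymmetricGroupCharacterProjectors`
   (`Z_λ` kills every Specht constituent `S^μ`, `μ ≠ λ`, and `S^λ = k[S_n] c_λ` is generated by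
   `c_λ = (f^λ/n!) c_λ²`) show `Z_λ ∘ P = 0` for the equivariant projection `P` onto a complement
   of `M` (Maschke), whence `range Z_λ ⊆ M`.

References: M. Christandl, P. Vrana, J. Zuiddam, J. Amer. Math. Soc. 36 (2023), Remark 3.33
[cite: ChristandlVranaZuiddam2023, Remark 3.33]; W. Fulton, J. Harris, *Representation Theory*,
GTM 129, Lemma 4.21, Lemma 4.26, Thm. 6.3 [FultonHarrisGTM129]; W. Fulton, *Young Tableaux*,
§8.1 (the vectors `e_T` vanish unless the column entries are distinct). No new definitions.
-/

noncomputable section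

open scoped BigOperators

namespace Literature.NumberTheory.DiophantineGeometry

section Support

variable {k : Type*} [Field k] {N n : ℕ}

/-! ### 1. The column antisymmetrizer kills words with a repeated letter in a column -/

/-- Operator form of `of_mul_colAntisymmetrizer`: `ρ(q) ∘ B = sgn(q) B` for the operator `B` of the
column antisymmetrizer and `q ∈ C_μ`. [cite: FultonHarrisGTM129, Lemma 4.21 (2)] -/
theorem rep_comp_asAlgebraHom_colAntisymmetrizer {V : Type*} [AddCommGroup V] [Module k V]
    (ρ : Representation k (Equiv.Perm (Fin n)) V) {μ : Nat.Partition n}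
    {q : Equiv.Perm (Fin n)} (hq : q ∈ colStabilizer μ) :
    ρ q ∘ₗ ρ.asAlgebraHom (colAntisymmetrizer k μ) =
      ((Equiv.Perm.sign q : ℤ) : k) • ρ.asAlgebraHom (colAntisymmetrizer k μ) := by
  rw [← Representation.asAlgebraHom_of, ← Module.End.mul_eq_comp, ← map_mul,
    of_mul_colAntisymmetrizer (k := k) hq, map_smul]

/-- **Step 1.** For every vector `c` of the word model and every word `u` that repeats a letter at
two positions `p ≠ q` of one column of the canonical tableau of `μ`, the `u`-coordinate of
`b_μ · c` vanishes (characteristic zero): the transposition `(p q) ∈ C_μ` fixes `u` and acts by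
`-1` on `b_μ · c`. [cite: FultonHarrisGTM129, Lemma 4.21 (2)] -/
theorem colAntisymmetrizer_apply_apply_eq_zero [CharZero k] (μ : Nat.Partition n)
    (c : Word N n → k) {u : Word N n} {p q : Fin n} (hpq : p ≠ q) (hcol : μ.colOf p = μ.colOf q)
    (hu : u p = u q) :
    (wordPermRep k N n).asAlgebraHom (colAntisymmetrizer k μ) c u = 0 := by
  set B := (wordPermRep k N n).asAlgebraHom (colAntisymmetrizer k μ) with hB
  have hτ : Equiv.swap p q ∈ colStabilizer μ := swap_mem_colStabilizer μ hcol
  have hop : (wordPermRep k N n) (Equiv.swap p q) ∘ₗ B = -B := by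
    rw [hB, rep_comp_asAlgebraHom_colAntisymmetrizer _ hτ, Equiv.Perm.sign_swap hpq]
    simp only [Units.val_neg, Units.val_one, Int.cast_neg, Int.cast_one]
    exact neg_one_smul k ((wordPermRep k N n).asAlgebraHom (colAntisymmetrizer k μ))
  have huτ : u ∘ ⇑(Equiv.swap p q) = u := by
    funext i
    simp only [Function.comp_apply]
    rcases eq_or_ne i p with rfl | hip
    · rw [Equiv.swap_apply_left, hu]
    rcases eq_or_ne i q with rfl | hiq
    · rw [Equiv.swap_apply_right, hu]
    rw [Equiv.swap_apply_of_ne_of_ne hip hiq]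
  have h1 : ((wordPermRep k N n) (Equiv.swap p q) (B c)) u = B c u := by
    rw [wordPermRep_apply, wordPerm_apply, huτ]
  have h2 : ((wordPermRep k N n) (Equiv.swap p q) (B c)) u = -B c u := by
    have := LinearMap.congr_fun hop c
    rw [LinearMap.comp_apply, LinearMap.neg_apply] at this
    rw [this, Pi.neg_apply]
  have h3 : (2 : k) * B c u = 0 := by
    have : B c u = -B c u := h1.symm.trans h2
    linear_combination this
  rcases mul_eq_zero.1 h3 with h | h
  · exact absurd h two_ne_zero
  · exact h

/-! ### 2. Supports of `c_μ · x`: row permutations of column-injective words -/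

open scoped Classical in
/-- **Step 2.** Every word `u` in the support of `c_μ · x = a_μ b_μ x` is a row permutation of a
column-injective word: for some `r ∈ R_μ`, the word `u ∘ r` has pairwise distinct letters in each
column of the canonical tableau. [cite: FultonHarrisGTM129, §4.2 (proof of Lemma 4.26)] -/
theorem exists_colInjective_of_youngSymmetrizer_apply_ne_zero [CharZero k] (μ : Nat.Partition n)
    (x : Word N n → k) {u : Word N n}
    (hu : (wordPermRep k N n).asAlgebraHom (youngSymmetrizer k μ) x u ≠ 0) :
    ∃ r ∈ rowStabilizer μ, IsColStrict μ (u ∘ ⇑r) := by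
  set B := (wordPermRep k N n).asAlgebraHom (colAntisymmetrizer k μ) with hB
  have h1 : (wordPermRep k N n).asAlgebraHom (youngSymmetrizer k μ) x =
      (wordPermRep k N n).asAlgebraHom (rowSymmetrizer k μ) (B x) := by
    rw [youngSymmetrizer, map_mul]
    rfl
  rw [h1, asAlgebraHom_rowSymmetrizer_apply, Finset.sum_apply] at hu
  obtain ⟨r, hr, hne⟩ := Finset.exists_ne_zero_of_sum_ne_zero hu
  rw [Set.mem_toFinset, SetLike.mem_coe] at hr
  refine ⟨r, hr, fun p q hcol heq => ?_⟩
  by_contra hpq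
  apply hne
  rw [wordPermRep_apply, wordPerm_apply]
  exact colAntisymmetrizer_apply_apply_eq_zero μ x (u := u ∘ ⇑r) hpq hcol heq

/-! ### 3. Column-injective words are dominated by `μ` -/

/-- `rowOf p < m ↔ p < μ₁ + ⋯ + μ_m` for the canonical row-reading tableau. [folklore] -/
theorem rowOf_lt_iff (μ : Nat.Partition n) (p : Fin n) (m : ℕ) :
    μ.rowOf p < m ↔ (p : ℕ) < (μ.sortedParts.take m).sum := by
  rcases Nat.eq_zero_or_pos m with rfl | hm
  · simp
  · obtain ⟨r, rfl⟩ : ∃ r, m = r + 1 := ⟨m - 1, by omega⟩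
    by_cases hr : r < μ.sortedParts.length
    · have h := μ.sum_take_succ_le_iff_lt_rowOf p hr
      constructor
      · intro hlt
        by_contra hge
        push Not at hge
        have := h.1 hge
        omega
      · intro hlt
        by_contra hge
        push Not at hge
        have := h.2 (by omega)
        omega
    · push Not at hr
      have h1 : μ.rowOf p < r + 1 := lt_of_lt_of_le (μ.rowOf_lt_length p) (by omega)
      have h2 : (μ.sortedParts.take (r + 1)).sum = n := by
        rw [List.take_of_length_le (by omega), μ.sum_sortedParts]
      simp only [h1, h2, p.2]

/-- The number of positions in the first `m` rows is `μ₁ + ⋯ + μ_m`. [folklore] -/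
theorem card_filter_rowOf_lt (μ : Nat.Partition n) (m : ℕ) :
    (Finset.univ.filter fun p : Fin n => μ.rowOf p < m).card = (μ.sortedParts.take m).sum := by
  have hle : (μ.sortedParts.take m).sum ≤ n := by
    calc (μ.sortedParts.take m).sum ≤ μ.sortedParts.sum := List.Sublist.sum_le_sum
          (List.take_sublist m _) (fun _ _ => Nat.zero_le _)
      _ = n := μ.sum_sortedParts
  set K := (μ.sortedParts.take m).sum with hK
  have h1 : (Finset.univ.filter fun p : Fin n => μ.rowOf p < m) =
      Finset.univ.filter fun p : Fin n => (p : ℕ) < K := by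
    ext p
    simp only [Finset.mem_filter, Finset.mem_univ, true_and]
    exact rowOf_lt_iff μ p m
  rw [h1]
  -- `|{p : Fin n | p < K}| = K` for `K ≤ n`
  rw [← Finset.card_map Fin.valEmbedding]
  have h2 : (Finset.univ.filter fun p : Fin n => (p : ℕ) < K).map Fin.valEmbedding =
      Finset.range K := by
    ext j
    simp only [Finset.mem_map, Finset.mem_filter, Finset.mem_univ, true_and,
      Fin.valEmbedding_apply, Finset.mem_range]
    constructor
    · rintro ⟨i, hi, rfl⟩
      exact hi
    · intro hj
      exact ⟨⟨j, lt_of_lt_of_le hj hle⟩, hj, rfl⟩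
  rw [h2, Finset.card_range]

/-- In one column of the canonical tableau, the positions with letters in `S` of a column-strict
word are at most as many as the positions of that column lying in the first `|S|` rows (both
numbers being compared with `min(|S|, colLen)`). [folklore] -/
theorem card_filter_col_mem_le (μ : Nat.Partition n) {u : Word N n} (hu : IsColStrict μ u)
    (S : Finset (Fin N)) (j : ℕ) :
    (Finset.univ.filter fun p : Fin n => μ.colOf p = j ∧ u p ∈ S).card ≤
      (Finset.univ.filter fun p : Fin n => μ.colOf p = j ∧ μ.rowOf p < S.card).card := by
  classical
  rw [card_filter_colOf_eq_and_rowOf_lt μ j S.card, le_min_iff]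
  constructor
  · refine Finset.card_le_card_of_injOn u (fun p hp => ?_) ?_
    · simp only [Finset.coe_filter, Finset.mem_univ, true_and, Set.mem_setOf_eq] at hp
      exact hp.2
    · intro p hp q hq hpq
      simp only [Finset.coe_filter, Finset.mem_univ, true_and, Set.mem_setOf_eq] at hp hq
      exact hu (hp.1.trans hq.1.symm) hpq
  · calc (Finset.univ.filter fun p : Fin n => μ.colOf p = j ∧ u p ∈ S).card
        ≤ (Finset.univ.filter fun p : Fin n => μ.colOf p = j ∧
            μ.rowOf p < μ.youngDiagram.colLen j).card := by
          refine Finset.card_le_card fun p hp => ?_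
          simp only [Finset.mem_filter, Finset.mem_univ, true_and] at hp ⊢
          exact ⟨hp.1, hp.1 ▸ rowOf_lt_colLen μ p⟩
      _ = μ.youngDiagram.colLen j := by
          rw [card_filter_colOf_eq_and_rowOf_lt, min_self]

/-- **Step 3.** A column-injective word is dominated by `μ`: `#{p | u p ∈ S} ≤ μ₁ + ⋯ + μ_{|S|}`
for every set `S` of letters. [cite: ChristandlVranaZuiddam2023, Remark 3.33] -/
theorem card_filter_mem_le_of_isColStrict (μ : Nat.Partition n) {u : Word N n}
    (hu : IsColStrict μ u) (S : Finset (Fin N)) :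
    (Finset.univ.filter fun p : Fin n => u p ∈ S).card ≤ (μ.sortedParts.take S.card).sum := by
  classical
  have hmaps : ∀ (s : Finset (Fin n)), (s : Set (Fin n)).MapsTo μ.colOf (Finset.range n) :=
    fun s p _ => Finset.mem_coe.2 (Finset.mem_range.2 (colOf_lt μ p))
  rw [← card_filter_rowOf_lt μ S.card,
    Finset.card_eq_sum_card_fiberwise (hmaps (Finset.univ.filter fun p : Fin n => u p ∈ S)),
    Finset.card_eq_sum_card_fiberwise
      (hmaps (Finset.univ.filter fun p : Fin n => μ.rowOf p < S.card))]
  refine Finset.sum_le_sum fun j _ => ?_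
  have e1 : (Finset.univ.filter fun p : Fin n => u p ∈ S).filter (fun p => μ.colOf p = j) =
      Finset.univ.filter fun p : Fin n => μ.colOf p = j ∧ u p ∈ S := by
    ext p; simp [and_comm]
  have e2 : (Finset.univ.filter fun p : Fin n => μ.rowOf p < S.card).filter
      (fun p => μ.colOf p = j) =
      Finset.univ.filter fun p : Fin n => μ.colOf p = j ∧ μ.rowOf p < S.card := by
    ext p; simp [and_comm]
  rw [e1, e2]
  exact card_filter_col_mem_le μ hu S j

/-- The number of positions with letters in `S` is invariant under permuting the positions.
[folklore] -/
theorem card_filter_comp_perm_mem (u : Word N n) (r : Equiv.Perm (Fin n)) (S : Finset (Fin N)) :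
    (Finset.univ.filter fun p : Fin n => u (r p) ∈ S).card =
      (Finset.univ.filter fun p : Fin n => u p ∈ S).card := by
  refine Finset.card_bij (fun p _ => r p) (fun p hp => ?_) (fun p _ q _ h => r.injective h)
    (fun q hq => ⟨r.symm q, ?_, by simp⟩)
  · simpa using hp
  · simpa using hq

/-- **Steps 2–3 combined.** Every word in the support of `c_μ · x` is dominated by `μ`.
[cite: ChristandlVranaZuiddam2023, Remark 3.33] -/
theorem card_filter_mem_le_of_youngSymmetrizer_apply_ne_zero [CharZero k] (μ : Nat.Partition n)
    (x : Word N n → k) {u : Word N n}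
    (hu : (wordPermRep k N n).asAlgebraHom (youngSymmetrizer k μ) x u ≠ 0) (S : Finset (Fin N)) :
    (Finset.univ.filter fun p : Fin n => u p ∈ S).card ≤ (μ.sortedParts.take S.card).sum := by
  obtain ⟨r, -, hr⟩ := exists_colInjective_of_youngSymmetrizer_apply_ne_zero μ x hu
  rw [← card_filter_comp_perm_mem u r S]
  exact card_filter_mem_le_of_isColStrict μ hr S

/-! ### 4. The range of the character sum `Z_λ` is supported on dominated words -/

/-- Intertwining maps commute with the action of the group algebra. [folklore] -/
theorem intertwiningMap_asAlgebraHom_apply {G V W : Type*} [Group G] [AddCommGroup V] [Module k V]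
    [AddCommGroup W] [Module k W] {ρ : Representation k G V} {ρ' : Representation k G W}
    (f : ρ.IntertwiningMap ρ') (a : MonoidAlgebra k G) (v : V) :
    f (ρ.asAlgebraHom a v) = ρ'.asAlgebraHom a (f v) := by
  induction a using MonoidAlgebra.induction_on with
  | hM g => rw [Representation.asAlgebraHom_of, Representation.asAlgebraHom_of, f.isIntertwining]
  | hadd a b ha hb => rw [map_add, LinearMap.add_apply, map_add, ha, hb, map_add, LinearMap.add_apply]
  | hsmul r a ha => rw [map_smul, LinearMap.smul_apply, map_smul, ha, map_smul, LinearMap.smul_apply]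

/-- A subrepresentation is stable under the group algebra. [folklore] -/
theorem asAlgebraHom_mem_of_forall_mem {G V : Type*} [Group G] [AddCommGroup V] [Module k V]
    (ρ : Representation k G V) (M : Submodule k V) (hM : ∀ g, ∀ v ∈ M, ρ g v ∈ M)
    (a : MonoidAlgebra k G) {v : V} (hv : v ∈ M) : ρ.asAlgebraHom a v ∈ M := by
  induction a using MonoidAlgebra.induction_on with
  | hM g => rw [Representation.asAlgebraHom_of]; exact hM g v hv
  | hadd a b ha hb => rw [map_add, LinearMap.add_apply]; exact add_mem ha hb
  | hsmul r a ha => rw [map_smul, LinearMap.smul_apply]; exact Submodule.smul_mem _ r ha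

/-- Every intertwining map from the Specht module `S^λ` into a representation `ρ` takes values in
any subrepresentation `M` of `ρ` containing `c_λ · V`: `S^λ = k[S_n] c_λ` and
`c_λ = (f^λ/n!) c_λ²`. [cite: FultonHarrisGTM129, Lemma 4.26] -/
theorem intertwiningMap_spechtRep_mem [CharZero k] {V : Type*} [AddCommGroup V] [Module k V]
    (ρ : Representation k (Equiv.Perm (Fin n)) V) (M : Submodule k V)
    (hM : ∀ g, ∀ v ∈ M, ρ g v ∈ M) {lam : Nat.Partition n}
    (hc : ∀ v : V, ρ.asAlgebraHom (youngSymmetrizer k lam) v ∈ M)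
    (ι : (spechtRep k lam).IntertwiningMap ρ) (x : spechtIdeal k lam) : ι x ∈ M := by
  -- `x = y * c`, and `c = n⁻¹ • c * c`
  obtain ⟨y, hy⟩ := Ideal.mem_span_singleton'.1 x.2
  set c := youngSymmetrizer k lam with hcdef
  set m : ℕ := n.factorial / numStandardTableaux lam with hm
  have hcc : c * c = (m : k) • c := youngSymmetrizer_mul_self_holds (k := k) lam
  have hm0 : (m : k) ≠ 0 := by
    rw [hm, Nat.cast_ne_zero]
    have hdiv := numStandardTableaux_mul_prod_hookLength_holds lam
    have hpos := numStandardTableaux_pos_holds lam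
    intro h0
    rw [Nat.div_eq_zero_iff] at h0
    rcases h0 with h0 | h0
    · exact hpos.ne' h0
    · -- `f^λ ∣ n!` and `f^λ > n!` is impossible
      have : numStandardTableaux lam ≤ n.factorial := by
        rw [← hdiv]
        refine Nat.le_mul_of_pos_right _ (Finset.prod_pos fun cell hcell => ?_)
        exact one_le_hookLength hcell
      omega
  let cS : spechtIdeal k lam := ⟨c, youngSymmetrizer_mem_spechtIdeal k lam⟩
  -- the action of the group algebra on `S^λ` is left multiplication
  have hact : ∀ (a : MonoidAlgebra k (Equiv.Perm (Fin n))) (z : spechtIdeal k lam),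
      ((spechtRep k lam).asAlgebraHom a z : MonoidAlgebra k (Equiv.Perm (Fin n))) = a * z := by
    intro a z
    rw [asAlgebraHom_spechtRep, Algebra.lsmul_coe]
    rfl
  -- `ι cS ∈ M`
  have hcS : ι cS ∈ M := by
    have h1 : cS = (spechtRep k lam).asAlgebraHom ((m : k)⁻¹ • c) cS := by
      apply Subtype.ext
      rw [hact, smul_mul_assoc, hcc, inv_smul_smul₀ hm0]
    rw [h1, intertwiningMap_asAlgebraHom_apply, map_smul, LinearMap.smul_apply]
    exact Submodule.smul_mem _ _ (hc _)
  -- `x = y • cS`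
  have h2 : x = (spechtRep k lam).asAlgebraHom y cS := by
    apply Subtype.ext
    rw [hact, hy]
  rw [h2, intertwiningMap_asAlgebraHom_apply]
  exact asAlgebraHom_mem_of_forall_mem ρ M hM y hcS

/-- The equivariant projection onto a complement: for complementary subrepresentations `M', M` of
`ρ`, the projection onto `M'` along `M` commutes with `ρ`. [folklore] -/
theorem projection_comm_of_stable {G V : Type*} [Group G] [AddCommGroup V] [Module k V]
    (ρ : Representation k G V) {M' M : Submodule k V} (h : IsCompl M' M)
    (hM' : ∀ g, ∀ v ∈ M', ρ g v ∈ M') (hM : ∀ g, ∀ v ∈ M, ρ g v ∈ M) (g : G) (v : V) :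
    M'.projection M h (ρ g v) = ρ g (M'.projection M h v) := by
  set P := M'.projection M h with hP
  have hv1 : P v ∈ M' := Submodule.projection_apply_mem h v
  have hv2 : v - P v ∈ M := by
    rw [← Submodule.projection_apply_eq_zero_iff h, map_sub,
      Submodule.projection_apply_of_mem_left h hv1, sub_self]
  have hdec : ρ g v = ρ g (P v) + ρ g (v - P v) := by rw [← map_add, add_sub_cancel]
  rw [hdec, map_add, Submodule.projection_apply_of_mem_left h (hM' g _ hv1),
    (Submodule.projection_apply_eq_zero_iff h).2 (hM g _ hv2), add_zero]

/-- **The majorisation property (CVZ Remark 3.33), support form.** Over an algebraically closed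
field of characteristic zero, every word `u` in the support of a vector in the range of the
character sum `Z_λ = ∑_π χ^λ(π) π` on `Word N n → k` (a nonzero multiple of the isotypic
projector `P_λ`) is dominated by `λ`: `#{p | u p ∈ S} ≤ λ₁ + ⋯ + λ_{|S|}` for all sets `S` of
letters. [cite: ChristandlVranaZuiddam2023, Remark 3.33] -/
theorem card_filter_mem_le_of_mem_range_charSum [IsAlgClosed k] [CharZero k]
    (lam : Nat.Partition n) {x : Word N n → k}
    (hx : x ∈ LinearMap.range (∑ π, spechtCharacter k lam π • wordPermRep k N n π))
    {u : Word N n} (hu : x u ≠ 0) (S : Finset (Fin N)) :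
    (Finset.univ.filter fun p : Fin n => u p ∈ S).card ≤ (lam.sortedParts.take S.card).sum := by
  classical
  set ρ := wordPermRep k N n with hρ
  -- the dominated words and the subspace `M` of vectors supported on them
  set D : Set (Word N n) := {u | ∀ S : Finset (Fin N),
    (Finset.univ.filter fun p : Fin n => u p ∈ S).card ≤ (lam.sortedParts.take S.card).sum} with hD
  let M : Submodule k (Word N n → k) :=
    { carrier := {y | ∀ u, u ∉ D → y u = 0}
      add_mem' := fun {a b} ha hb u hu => by simp [ha u hu, hb u hu]
      zero_mem' := fun u _ => rfl
      smul_mem' := fun r {a} ha u hu => by simp [ha u hu] }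
  have hMmem : ∀ y : Word N n → k, y ∈ M ↔ ∀ u, u ∉ D → y u = 0 := fun y => Iff.rfl
  -- `D` is stable under permuting positions, hence `M` is a subrepresentation
  have hDperm : ∀ (u : Word N n) (σ : Equiv.Perm (Fin n)), u ∈ D → u ∘ ⇑σ ∈ D := by
    intro u σ huD S'
    have := huD S'
    rw [show (Finset.univ.filter fun p : Fin n => (u ∘ ⇑σ) p ∈ S') =
      Finset.univ.filter fun p : Fin n => u (σ p) ∈ S' from rfl, card_filter_comp_perm_mem u σ S']
    exact this
  have hM : ∀ g, ∀ v ∈ M, ρ g v ∈ M := by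
    intro g v hv u huD
    rw [hρ, wordPermRep_apply, wordPerm_apply]
    refine hv _ fun h => huD ?_
    have := hDperm _ g⁻¹ h
    rwa [Function.comp_assoc, ← Equiv.Perm.coe_mul, mul_inv_cancel, Equiv.Perm.coe_one,
      Function.comp_id] at this
  -- `c_λ · y ∈ M` for every `y`
  have hcM : ∀ y : Word N n → k, ρ.asAlgebraHom (youngSymmetrizer k lam) y ∈ M := by
    intro y u huD
    by_contra hne
    exact huD fun S' => card_filter_mem_le_of_youngSymmetrizer_apply_ne_zero lam y hne S'
  -- an invariant complement `M'` (Maschke) and the equivariant projection onto it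
  haveI : NeZero (Nat.card (Equiv.Perm (Fin n)) : k) := ⟨Nat.cast_ne_zero.2 Nat.card_pos.ne'⟩
  let Msub : Subrepresentation ρ := ⟨M, fun g v hv => hM g v hv⟩
  obtain ⟨M'sub, hcompl⟩ := exists_isCompl Msub
  set M' : Submodule k (Word N n → k) := M'sub.toSubmodule with hM'def
  have hM' : ∀ g, ∀ v ∈ M', ρ g v ∈ M' := fun g v hv => M'sub.apply_mem_toSubmodule g hv
  have hcompl' : IsCompl M' M := by
    constructor
    · rw [disjoint_iff]
      have h := congrArg Subrepresentation.toSubmodule (disjoint_iff.1 hcompl.symm.disjoint)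
      rw [Subrepresentation.toSubmodule_inf] at h
      exact h
    · rw [codisjoint_iff]
      have h := congrArg Subrepresentation.toSubmodule (codisjoint_iff.1 hcompl.symm.codisjoint)
      rw [Subrepresentation.toSubmodule_sup] at h
      exact h
  set P := M'.projection M hcompl' with hPdef
  have hPcomm : ∀ g v, P (ρ g v) = ρ g (P v) := projection_comm_of_stable ρ hcompl' hM' hM
  -- `Z_λ ∘ P` is an intertwining self-map killing every Specht constituent, hence zero
  set Zl : Module.End k (Word N n → k) := ∑ π, spechtCharacter k lam π • ρ π with hZl
  let Pint : ρ.IntertwiningMap ρ := ⟨P, fun g => LinearMap.ext fun v => hPcomm g v⟩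
  have hZP : ∀ g, (Zl ∘ₗ P) ∘ₗ ρ g = ρ g ∘ₗ (Zl ∘ₗ P) := by
    intro g
    rw [LinearMap.comp_assoc, show P ∘ₗ ρ g = ρ g ∘ₗ P from LinearMap.ext fun v => hPcomm g v,
      ← LinearMap.comp_assoc, charSum_comp_rep, LinearMap.comp_assoc]
  let T : ρ.IntertwiningMap ρ := ⟨Zl ∘ₗ P, hZP⟩
  have hT : T = 0 := by
    refine intertwiningMap_eq_zero_of_comp_spechtRep ρ T fun μ ι z => ?_
    change Zl (P (ι z)) = 0
    have hnat : Zl (P (ι z)) = P (Zl (ι z)) := by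
      have := intertwiningMap_charSum_apply Pint lam (ι z)
      exact this.symm
    rw [hnat, hZl, charSum_comp_intertwiningMap_spechtRep ρ lam μ ι z, map_smul]
    by_cases h : lam = μ
    · subst h
      rw [(Submodule.projection_apply_eq_zero_iff hcompl').2
        (intertwiningMap_spechtRep_mem ρ M hM hcM ι z), smul_zero]
    · rw [if_neg h, zero_smul]
  -- hence `range Z_λ ⊆ M`
  have hrange : ∀ v, Zl v ∈ M := by
    intro v
    have hv2 : v - P v ∈ M := by
      rw [← Submodule.projection_apply_eq_zero_iff hcompl', map_sub,
        Submodule.projection_apply_of_mem_left hcompl' (Submodule.projection_apply_mem hcompl' v),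
        sub_self]
    have h0 : Zl (P v) = 0 := by
      have := congrArg (fun f : ρ.IntertwiningMap ρ => f v) hT
      exact this
    have hdec : Zl v = Zl (P v) + Zl (v - P v) := by rw [← map_add, add_sub_cancel]
    rw [hdec, h0, zero_add, hZl, charSum_apply]
    refine Submodule.sum_mem _ fun π _ => Submodule.smul_mem _ _ (hM π _ hv2)
  -- conclude
  obtain ⟨v, rfl⟩ := hx
  have hmem := hrange v
  rw [hMmem] at hmem
  by_contra hnot
  exact hu (hmem u fun huD => hnot (huD S))

end Support

end Literature.NumberTheory.DiophantineGeometry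

end
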